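import Summits.KontsevichZagierPeriods.KontsevichZagierPeriods.Theorems.ValuedFieldSpecialisationCTConstructionCylinder
import Summits.KontsevichZagierPeriods.KontsevichZagierPeriods.Theorems.ValuedFieldSpecialisationCTConstructionLogPowCancellation

/-!
# Route ValuedFieldSpecialisation — crux `CTConstruction`: the all-`[μ, 1]` typed family

Helper toward crux stmt-KontsevichZagierPeriods-3495 (`CTConstruction`), line `registered`, stub
`stub_etaBox_specialFibre` of the lead's "dilation elimination" (pure-log phase). A **typed
elementary family** `R : KZ.IntegralRep (B + d + 2)` has coordinates `z = (s, u, t, w)`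
(`s = z 0` the parameter, `u = z 1`, the typed block `t : Fin B → ℝ` at the indices
`(Fin.castAdd d j).succ.succ`, `w : Fin d → ℝ` at the indices `(Fin.natAdd B l).succ.succ`),
domain `0 < s < 1`, `0 < u`, `u ^ Q * s ^ p < 1`, `κ j * s ^ (e j) ≤ t j ≤ 1`, `w ∈ r.domain`,
and integrand `∏ (t j)⁻¹ * r.integrand w`. When ALL block coordinates have type `[μ, 1]`
(`κ ≡ μ`, `e ≡ 0`) and `p = 0` (so that `u ^ Q * s ^ 0 < 1 ⟺ u < 1` for `u > 0`, `Q > 0`),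
the family does not depend on `s`: it IS (`KZ.IntegralRep.ext'`) the constant family
`V.cylinder = (0,1) × V` over its slice `V`, and `V` itself is the constant family
`(L_B.prod r).cylinder = (0,1) × ([μ,1]^B × r)` (coordinate `u`) over the product of the
log-power box `L_B = ([μ, 1]^B, ∏ t_j⁻¹)` (`exists_boxRep_one`) with `r`. Hence `R` is dominated
with special fibre `V` (`KZ.IntegralRep.isDominatedFamily_cylinder`) and
`[V] − [L_B] * [r] = [(L_B.prod r).cylinder] − [L_B.prod r] ∈ KZ.relations` (`KZ.of_mul_of`,
`of_cylinder_sub_of_mem_relations`).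

Sources: M. Kontsevich, D. Zagier, *Periods* (2001), §1.2 (rules (1)–(3)), §4.1 (Fubini product).
No new definitions.
-/

noncomputable section

namespace Summit.KontsevichZagierPeriods.ValuedFieldSpecialisation

open MeasureTheory Set Filter
open Literature.NumberTheory.Transcendental Literature.NumberTheory.Transcendental.KZ

/-- **The all-`[μ, 1]` typed family with `p = 0` is a double cylinder**: if `0 < Q`, then the typed
elementary family with `p = 0`, `κ ≡ μ`, `e ≡ 0` over `r` equals `((Lb.prod r).cylinder).cylinder`
for the box representation `Lb = ([μ, 1]^B, ∏ t_j⁻¹)` (same domain — `u ^ Q < 1 ⟺ u < 1` for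
`u > 0` — and same integrand `∏ (t j)⁻¹ * r.integrand w = (Lb ⊗ r) (t, w)`,
`KZ.IntegralRep.prod_integrand_eq`). [Kontsevich–Zagier 2001, §1.2, §4.1] [folklore] -/
theorem typedRep_eq_cylinder_cylinder {Q p B d : ℕ} {μ : ℚ} {κ : Fin B → ℚ} {e : Fin B → ℕ}
    (r : IntegralRep d) (R : IntegralRep (B + d + 1 + 1)) (Lb : IntegralRep B) (hQ : 0 < Q)
    (hp : p = 0) (hκ : ∀ j, κ j = μ) (he : ∀ j, e j = 0)
    (hR : R.domain = {z | ∃ (s u : ℝ) (t : Fin B → ℝ) (w : Fin d → ℝ),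
      z = Matrix.vecCons s (Matrix.vecCons u (Fin.append t w)) ∧ 0 < s ∧ s < 1 ∧ 0 < u ∧
        u ^ Q * s ^ p < 1 ∧ (∀ j, ((κ j : ℚ) : ℝ) * s ^ (e j) ≤ t j ∧ t j ≤ 1) ∧ w ∈ r.domain})
    (hRi : R.integrand = fun z => (∏ j : Fin B, (z (Fin.castAdd d j).succ.succ)⁻¹) *
      r.integrand (fun l : Fin d => z (Fin.natAdd B l).succ.succ))
    (hLb : Lb.domain = {t | ∀ j, (μ : ℝ) ≤ t j ∧ t j ≤ 1})
    (hLbi : Lb.integrand = fun t => ∏ j, (t j)⁻¹) :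
    R = (Lb.prod r).cylinder.cylinder := by
  subst hp
  refine IntegralRep.ext' ?_ ?_
  · rw [hR, typedDomain_eq Q 0 B (fun j => ((κ j : ℚ) : ℝ)) e r]
    ext z
    simp only [mem_setOf_eq, hκ, he, pow_zero, mul_one, IntegralRep.domain_cylinder,
      IntegralRep.cylinderDomain, Fin.succ_zero_eq_one, IntegralRep.prod_domain,
      IntegralRep.mem_prodDomain, hLb]
    constructor
    · rintro ⟨h0, h1, hu, huq, ht, hw⟩
      exact ⟨h0, h1, hu, (pow_lt_one_iff_of_nonneg hu.le hQ.ne').mp huq, ht, hw⟩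
    · rintro ⟨h0, h1, hu, hu1, ht, hw⟩
      exact ⟨h0, h1, hu, (pow_lt_one_iff_of_nonneg hu.le hQ.ne').mpr hu1, ht, hw⟩
  · rw [hRi]
    funext z
    simp only [IntegralRep.integrand_cylinder, IntegralRep.prod_integrand_eq,
      IntegralRep.prodFun_apply, hLbi]

/-- **Stub `stub_etaBox_specialFibre`** (pure-log phase of dilation elimination). For `Q > 0`,
`p = 0`, a rational `0 < μ ≤ 1` and the typed elementary family `R` over `r` all of whose block
coordinates have type `[μ, 1]` (`κ ≡ μ`, `e ≡ 0`): there are `V : KZ.IntegralRep (B + d + 1)` and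
the box `Lb = ([μ, 1]^B, ∏ t_j⁻¹)` (`exists_boxRep_one`) such that `R` is dominated near `s = 0⁺`
by `V.abs` with special fibre `V` and `[V] − [Lb] * [r] ∈ KZ.relations`. Indeed with
`V = (Lb.prod r).cylinder` one has `R = V.cylinder` on the nose (`typedRep_eq_cylinder_cylinder`),
so domination is `KZ.IntegralRep.isDominatedFamily_cylinder`, and
`[V] − [Lb] * [r] = [(Lb.prod r).cylinder] − [Lb.prod r]` (`KZ.of_mul_of`) is a relation by
`of_cylinder_sub_of_mem_relations`. [Kontsevich–Zagier 2001, §1.2 rules (1)–(3), §4.1]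
[folklore] -/
theorem stub_etaBox_specialFibre : ∀ (Q p B d : ℕ) (μ : ℚ) (κ : Fin B → ℚ) (e : Fin B → ℕ) (r : Literature.NumberTheory.Transcendental.KZ.IntegralRep d) (R : Literature.NumberTheory.Transcendental.KZ.IntegralRep (B + d + 1 + 1)), 0 < Q → p = 0 → 0 < μ → μ ≤ 1 → (∀ j, κ j = μ) → (∀ j, e j = 0) → R.domain = {z | ∃ (s u : ℝ) (t : Fin B → ℝ) (w : Fin d → ℝ), z = Matrix.vecCons s (Matrix.vecCons u (Fin.append t w)) ∧ 0 < s ∧ s < 1 ∧ 0 < u ∧ u ^ Q * s ^ p < 1 ∧ (∀ j, ((κ j : ℚ) : ℝ) * s ^ (e j) ≤ t j ∧ t j ≤ 1) ∧ w ∈ r.domain} → R.integrand = (fun z => (∏ j : Fin B, (z (Fin.castAdd d j).succ.succ)⁻¹) * r.integrand (fun l : Fin d => z (Fin.natAdd B l).succ.succ)) → ∃ (V : Literature.NumberTheory.Transcendental.KZ.IntegralRep (B + d + 1)) (Lb : Literature.NumberTheory.Transcendental.KZ.IntegralRep B), Literature.NumberTheory.Transcendental.KZ.IsDominatedFamily R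 V V.abs ∧ Lb.domain = {t | ∀ j, (μ : ℝ) ≤ t j ∧ t j ≤ 1} ∧ Lb.integrand = (fun t => ∏ j, (t j)⁻¹) ∧ Literature.NumberTheory.Transcendental.KZ.of V - Literature.NumberTheory.Transcendental.KZ.of Lb * Literature.NumberTheory.Transcendental.KZ.of r ∈ Literature.NumberTheory.Transcendental.KZ.relations := by
  intro Q p B d μ κ e r R hQ hp hμ _ hκ he hR hRi
  obtain ⟨Lb, hLb, hLbi⟩ := exists_boxRep_one B μ hμ
  refine ⟨(Lb.prod r).cylinder, Lb, ?_, hLb, hLbi, ?_⟩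
  · rw [typedRep_eq_cylinder_cylinder r R Lb hQ hp hκ he hR hRi hLb hLbi]
    exact IntegralRep.isDominatedFamily_cylinder _
  · rw [of_mul_of]
    exact of_cylinder_sub_of_mem_relations _

end Summit.KontsevichZagierPeriods.ValuedFieldSpecialisation
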